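import Summits.Ventures.QEC.Census.CSSK1SplitLPSound
import Summits.Ventures.QEC.Census.CSS.K1LP16CertsB8
import Summits.Ventures.QEC.Census.CSS.K1LP16CertsB9
import Summits.Ventures.QEC.Census.CSS.K1LP16CertsB10B11
import HarnessLib

/-!
# Cell `(16, 1)` of the optimal-CSS table: every CSS `[[16, 1, ≥ 5]]` code has `{rank H^X, rank H^Z} = {7, 8}` and translate weight `w ∈ {5, 7}`

LADDER-QEC (venture cell `qec`), CENSUS-PREREG C.2 extension `13 ≤ n ≤ 16`, cell `(16, 1)` — the last cell of the optimal-CSS-distance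
table `n ≤ 16` not KERNEL in both columns (KERNEL lower bound `4`: `[[16,1,4]]` `Census/CSS/CalibCSSN16P1.lean`; KERNEL upper bound `≤ 5`:
`cssUpperLP_16_1`; COMPUTED upper bound `≤ 4`: qec-type-02 g6's exhaustive normal-form search census/type-02/css161, 0 solutions in ten
sub-cells `(b, w)`, `b = rank H^Z ∈ {8, …, 11}` after the `X ↔ Z` swap, `w = |supp s| ∈ [5, 16 − b]`).
THIS FILE (type-10 lane, KERNEL, 0 kit): the split linear program of the `k = 1` normal form (`Census/CSSK1SplitLP.lean`) is
INFEASIBLE in EIGHT of the ten sub-cells — `(11,5)`, `(10,5)`, `(10,6)`, `(9,5)`, `(9,6)`, `(9,7)`, `(8,6)`, `(8,8)` (certificates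
`Census/CSS/K1LP16Certs*.lean`) — hence:
* `css_16_1_5_rankZ` — every CSS code on `16` qubits with `k = 1`, `d^Z ≥ 5`, `d^X ≥ 5` has `rank H^Z ∈ {7, 8}` (ranks `≥ 12` have no
  admissible `w`; ranks `≤ 6` are the `X ↔ Z` mirrors of ranks `≥ 9`);
* `k1_16_b8_wt` — at `rank H^Z = 8` (`|κ| = |μ| = 8`) every normal-form pair `(A, s)` satisfying `(Z)`, `(X)` at distance `5` has `wt s ∈ {5, 7}`.
So the `(16, 1)` question «is there a CSS `[[16,1,5]]`?» is reduced IN THE KERNEL to the two sub-cells `(b, w) = (8, 5)` and `(8, 7)` of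
qec-type-02's search (there the LP is feasible: at `(8, 7)` with an integral but unrealizable vertex, so no LP/branching certificate of this
family closes it; a kernel replay of the search or a stronger system is needed). The cell's CERTIFIED entry stays `4–5`; this file makes
8/10 of the COMPUTED evidence KERNEL. Tier KERNEL-std (every check `decide`/`decide +kernel`, axioms standard, no `native_decide`).
HONEST FRAMING: an LP relaxation refutes; it computes no distance; `(8,5)`/`(8,7)` are open here. [folklore] (weak LP duality + case split on the rank).
-/

namespace Summit.Ventures.QEC.Census.CSS

open Finset Matrix Summit.Ventures.QEC.Census Summit.Ventures.QEC.Census.CSSK1LP Literature.InformationTheory.QuantumCodes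

/-- Assembling a certificate table from per-`w` kernel checks (no re-evaluation of the certificates). [folklore] -/
theorem k1CertsCheck_of_forall {b m D : ℕ} {certs : ℕ → List (ℕ × ℕ × ℕ) × List ℚ}
    (h : ∀ w, D ≤ w → w ≤ m → farkasCheck (k1Rows b w (m - w) D (certs w).1) (certs w).2 (k1N b w (m - w)) = true) :
    k1CertsCheck b m D certs = true := by
  unfold k1CertsCheck
  refine List.all_eq_true.mpr fun w hw => ?_
  rw [List.mem_range] at hw
  by_cases hD : w < D
  · simp [hD]
  · rw [h w (by omega) (by omega), Bool.or_true]

/-- All `(9, w)` sub-cells (`w = 5, 6, 7`) are certified. [folklore] -/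
theorem certs16_9_ok : k1CertsCheck 9 (16 - 9) 5 certs16_9 = true :=
  k1CertsCheck_of_forall fun w h1 h2 => by
    interval_cases w
    · exact k1cert_16_9_5
    · exact k1cert_16_9_6
    · exact k1cert_16_9_7

/-- All `(10, w)` sub-cells (`w = 5, 6`) are certified. [folklore] -/
theorem certs16_10_ok : k1CertsCheck 10 (16 - 10) 5 certs16_10 = true :=
  k1CertsCheck_of_forall fun w h1 h2 => by
    interval_cases w
    · exact k1cert_16_10_5
    · exact k1cert_16_10_6

/-- The `(11, 5)` sub-cell (the only admissible `w` for `b = 11`) is certified. [folklore] -/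
theorem certs16_11_ok : k1CertsCheck 11 (16 - 11) 5 certs16_11 = true :=
  k1CertsCheck_of_forall fun w h1 h2 => by
    interval_cases w
    exact k1cert_16_11_5

/-- For `b = rank H^Z ≥ 12` there is no admissible translate weight (`5 ≤ w ≤ 16 − b ≤ 4`): the empty certificate table passes. [folklore] -/
theorem k1_16_certs_ge12_ok {b : ℕ} (hb : 12 ≤ b) : k1CertsCheck b (16 - b) 5 (fun _ => ([], [])) = true :=
  k1CertsCheck_of_forall fun w h1 h2 => by omega

variable {RX RZ : Type*} [Fintype RX] [Fintype RZ]

/-- No CSS code on `16` qubits with `k = 1` and `d^Z, d^X ≥ 5` has `rank H^Z ≥ 9` (certificates for `b = 9, 10, 11`; no admissible `w` for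
`b ≥ 12`). [folklore] -/
theorem css_16_1_5_rankZ_le (C : CSSCode RX RZ (Fin 16)) (hk : C.k = 1) (hZ : 5 ≤ C.dZ) (hX : 5 ≤ C.dX) : C.HZ.rank ≤ 8 := by
  by_contra h9
  set b := C.HZ.rank with hb
  by_cases h12 : 12 ≤ b
  · exact css_false_of_certs (k1_16_certs_ge12_ok h12) C hk hb.symm hZ hX
  have h9' : 9 ≤ b := by omega
  have h11 : b ≤ 11 := by omega
  interval_cases b
  · exact css_false_of_certs certs16_9_ok C hk hb.symm hZ hX
  · exact css_false_of_certs certs16_10_ok C hk hb.symm hZ hX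
  · exact css_false_of_certs certs16_11_ok C hk hb.symm hZ hX

/-- **Every CSS `[[16, 1, ≥ 5]]` code has `rank H^Z ∈ {7, 8}`** (equivalently `{rank H^X, rank H^Z} = {7, 8}`, as `rank H^X + rank H^Z = 15`):
the split linear program of the `k = 1` normal form is infeasible at every other rank (kernel-checked Farkas certificates; the `X ↔ Z`
swap `CSSCode.swap` handles `rank H^Z ≤ 6`). Eight of the ten sub-cells of the `(16, 1)` COMPUTED search are thereby KERNEL; `(8, 5)` and
`(8, 7)` remain. [folklore] -/
theorem css_16_1_5_rankZ (C : CSSCode RX RZ (Fin 16)) (hk : C.k = 1) (hZ : 5 ≤ C.dZ) (hX : 5 ≤ C.dX) :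
    C.HZ.rank = 7 ∨ C.HZ.rank = 8 := by
  have h1 := css_16_1_5_rankZ_le C hk hZ hX
  have h2 := css_16_1_5_rankZ_le C.swap (by rw [CSSCode.k_swap]; exact hk) (by rw [CSSCode.dZ_swap]; exact hX)
    (by rw [CSSCode.dX_swap]; exact hZ)
  rw [CSSCode.swap_HZ] at h2
  have hsum : C.HX.rank + C.HZ.rank = 15 := by
    have hk' := C.k_eq
    have hle := C.rank_HX_add_rank_HZ_le
    rw [Fintype.card_fin] at hk' hle
    omega
  omega

variable {κ μ : Type*} [Fintype κ] [Fintype μ] [DecidableEq κ] [DecidableEq μ]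

/-- **At `rank H^Z = 8` the normal-form translate has weight `5` or `7`.** For `|κ| = |μ| = 8`, every pair `(A, s)` satisfying the `k = 1`
normal-form conditions `(Z) ∀ v, 5 ≤ wt v + wt(vA + s)` and `(X) ∀ u, ⟨u,s⟩ = 1 → 5 ≤ wt u + wt(Au)` has `wt s ∈ {5, 7}`: `wt s ≥ 5` by `(Z)`
at `v = 0`, and the sub-cells `w = 6, 8` are LP-infeasible (`certs16_8_ok`). This is the residual input of the `(16, 1)` kernel replay:
only `(b, w) = (8, 5)` and `(8, 7)` need a search. [folklore] -/
theorem k1_16_b8_wt (hκ : Fintype.card κ = 8) (hμ : Fintype.card μ = 8) (A : Matrix κ μ (ZMod 2)) (s : μ → ZMod 2)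
    (hZ : ∀ v : κ → ZMod 2, 5 ≤ hammingNorm v + hammingNorm (v ᵥ* A + s))
    (hX : ∀ u : μ → ZMod 2, u ⬝ᵥ s = 1 → 5 ≤ hammingNorm u + hammingNorm (A *ᵥ u)) :
    hammingNorm s = 5 ∨ hammingNorm s = 7 := by
  classical
  set S := (univ : Finset μ).filter fun q => s q ≠ 0 with hS
  have hSn : #S = hammingNorm s := rfl
  have hw1 : 5 ≤ #S := by
    have h := hZ 0
    rw [Matrix.zero_vecMul, zero_add, hammingNorm_zero, zero_add] at h
    exact h
  have hw2 : #S ≤ 8 := (card_filter_le _ _).trans ((card_univ (α := μ)).le.trans hμ.le)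
  have hc : #Sᶜ = 8 - #S := by rw [Finset.card_compl S, hμ]
  have hZ' : ∀ v : κ → ZMod 2, 5 ≤ wtOn univ v + (#S - wtOn S (v ᵥ* A)) + wtOn Sᶜ (v ᵥ* A) := fun v => by
    have h := hZ v
    rw [hammingNorm_add_eq s (v ᵥ* A), ← hS, ← wtOn_univ] at h
    omega
  have hX' : ∀ u : μ → ZMod 2, wtOn S u % 2 = 1 → 5 ≤ wtOn univ u + wtOn univ (A *ᵥ u) := fun u hu => by
    have h := hX u (dotProduct_eq_one_of_wtOn s u hu)
    rwa [← wtOn_univ, ← wtOn_univ] at h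
  rw [← hSn]
  by_contra hne
  push Not at hne
  have hcases : #S = 6 ∨ #S = 8 := by omega
  rcases hcases with h6 | h8
  · exact false_of_farkasCheck A S certs16_8_ok.1 hκ h6 (by rw [hc, h6]) hZ' hX'
  · exact false_of_farkasCheck A S certs16_8_ok.2 hκ h8 (by rw [hc, h8]) hZ' hX'

end Summit.Ventures.QEC.Census.CSS
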